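import Summits.ResolutionOfSingularities.KangarooAtlas.MizutaniGroupScheme
import Literature.AlgebraicGeometry.Resolution.RidgeDimension
import Literature.AlgebraicGeometry.Resolution.PointBlowupRidge
import Literature.AlgebraicGeometry.Resolution.TriangularStandardMonomials
import HarnessLib

/-!
# Hironaka's triangular basis of `U(𝔭)`: `U_+(𝔭)S = (σ_1, …, σ_r)`, the additive forms of `U_+(𝔭)S` are those of `U(𝔭)`,
# and `U(𝔭)` is Giraud's algebra of invariants of `B_{P,𝔭}`

Cell `pub-rosobs`, Mizutani enclosure (seat mizutani-encloser-2, gen 5). AI-written; AI review is weaker than expert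
review; NOT a resolution-of-singularities theorem (summit relevance C).

> **Mizutani 1973, p. 85 L26–28.** "Then `U(p)` is generated as a `k`-algebra by purely inseparable forms in `S`, i.e.
> elements of the form `a_0X_0^{p^e} + ⋯ + a_nX_n^{p^e}` (See [2], Th. 1, Cor.)" — [2] = Hironaka 1970 (Ann. of Math. 92),
> whose Th. 1 gives the generators in TRIANGULAR form; **Giraud 1975 §1.6 (3)**: "`σ_i = X_i^{q(i)} + Σ_{j>i} c_{ij} X_j^{q(i)}`,
> `q(1) ≤ … ≤ q(e)`"; **Dietel 2015 Lemma (9.1.4)**: "`U_x` is a graded `k`-subalgebra … generated by homogeneous additive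
> polynomials, i.e. `U_x = k[Q_x]`", `Q_x := U_x ∩ L`.

For a point `𝔭` of `ℙ^n_k` (`IsPoint`), `char k = p`, with `U(𝔭) = multAlgebra k 𝔭`, `U_+(𝔭)S = bIdeal k 𝔭`,
`(U(𝔭) ∩ L)_e =` coefficient vectors `hirForms k p 𝔭 e` (encloser-1 g3) — all PROVED here:

1. `multAlgebra_eq_adjoin_range` — Hironaka's generation theorem (tree: `Hironaka1970_thm1_cor_holds`, cell res-hironaka)
   in the indexed shape `U(𝔭) = k[Σ_i a_i X_i^{p^e} : (e, a), a ∈ hirForms e]`; hence **`isGradedSubalgebra_multAlgebra`** and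
   **`isDiffStable_multAlgebra`** (`U(𝔭)` is stable under ALL Hasse–Schmidt derivations `D^{(β)}` — in print the first step of
   Dietel's proof of (9.1.4), here a corollary of generation, tree `isDiffStable_adjoin_sum_C_mul_X_pow`), and
   **`nonempty_triangularPresentation_multAlgebra`**: `U(𝔭) = k[σ_1, …, σ_r]` with a TRIANGULAR system of algebraically
   independent additive forms (tree `TriangularPresentation`, Hironaka–Giraud over any field).
2. `bIdeal_eq_span_range_gen` — **`U_+(𝔭)S = (σ_1, …, σ_r)`** for every triangular presentation.
3. `exists_addForm_sub_mem_span` — ELIMINATION along a triangular system (any subalgebra `U` with a presentation `P`):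
   every additive form `Σ c_i X_i^{p^e}` is congruent, modulo the `k`-span of the `σ_j^{p^{e−e_j}}` (`e_j ≤ e`), to one
   with zero coefficient at every pivot `ι(j)` with `e_j ≤ e`; `addForm_eq_zero_of_mem_span_range_gen` — such a reduced form
   lying in `(σ)` vanishes (its monomials are standard: tree `eq_zero_of_mem_span_of_forall_isTriStd`, the Gröbner reading of
   the triangular form); hence **`addForm_mem_span_pow_gen_of_mem`**: an additive form in the ideal `(σ)` is a `k`-combination
   of the `σ_j^{p^{e−e_j}}`, in particular lies in `U`.
4. **`mem_hirForms_of_addForm_mem_bIdeal`** / `addForm_mem_bIdeal_iff` — `L_e ∩ U_+(𝔭)S = (U(𝔭) ∩ L)_e`: the additive forms of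
   the IDEAL of `B_{P,𝔭}` are exactly those of the ALGEBRA `U(𝔭)` (Dietel's `Q_x`); `hirForms_eq_span_coef_pow` — `(U(𝔭) ∩ L)_e`
   is spanned by the coefficient vectors of the `σ_j^{p^{e−e_j}}`, `e_j ≤ e`.
5. **`ridgeAlgebra_bIdeal_eq_multAlgebra`** — `U(𝔭)` IS Giraud's algebra of invariants of the homogeneous additive group
   `B_{P,𝔭}` (tree `ridgeAlgebra p (bIdeal k 𝔭)`: the algebra generated by the additive forms of the ridge ideal of `B_{P,𝔭}`,
   which is `U_+(𝔭)S` itself by `ridgeIdeal_bIdeal`): Hironaka's definition of `B_{P,x}` through its ring of invariants `U_x`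
   (Dietel p. 6: "The ring of invariants `U_y` of `B_y` in `S` …") and Mizutani's Def. 1.1 agree in the tree.

## References

* H. Mizutani, *Hironaka's additive group schemes*, Nagoya Math. J. 52 (1973) 85–95, p. 85 L21–29, Def. 1.1, §1 (c).
  [Mizutani1973HironakaGroupSchemes]
* H. Hironaka, *Additive groups associated with points of a projective space*, Ann. of Math. 92 (1970) 327–334, Th. 1.
  [Hironaka1970AdditiveGroups]
* J. Giraud, *Contact maximal en caractéristique positive*, Ann. Sci. ÉNS (4) 8 (1975), §1.5, §1.6 (3). [Giraud1975]
* B. Dietel, Diss. Regensburg (2015), Def. (9.1.3), Lemma (9.1.4), Def. (9.1.5), p. 6. [Dietel2015]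
-/

noncomputable section

open MvPolynomial Literature.AlgebraicGeometry.Resolution Literature.AlgebraicGeometry.Resolution.HironakaScheme
open Literature.AlgebraicGeometry.Hironaka2017.EdgeAlgebra Literature.AlgebraicGeometry.Hironaka2017.Datum
open Literature.RingTheory.MvPolynomial

namespace Summit.ResolutionOfSingularities.KangarooAtlas.Mizutani

universe u

/-! ## 1. `U(𝔭)` is generated by additive forms: graded, Hasse–Schmidt stable, triangularly presented -/

section Generation

variable (k : Type u) [Field k] (p : ℕ) [hp : Fact p.Prime] [CharP k p] {n : ℕ}
  (𝔭 : Ideal (MvPolynomial (Fin (n + 1)) k))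

omit hp [CharP k p] in
/-- `addForm k p e a` is literally `Σ_i C(a_i) X_i^{p^e}`. [folklore] -/
theorem addForm_eq_sum (e : ℕ) (a : Fin (n + 1) → k) :
    addForm k p e a = ∑ i, C (a i) * X i ^ p ^ e := rfl

include hp in
/-- **Hironaka's generation theorem, indexed form**: `U(𝔭) = k[Σ_i a_i X_i^{p^e} : e ≥ 0, a ∈ (U(𝔭) ∩ L)_e]` for every point
`𝔭` of `ℙ^n_k`. [cite: Mizutani1973HironakaGroupSchemes, p. 85 L26–28; Hironaka1970AdditiveGroups, Th. 1 Cor.] -/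
theorem multAlgebra_eq_adjoin_range [𝔭.IsPrime] (hP : IsPoint k 𝔭) :
    multAlgebra k 𝔭 = Algebra.adjoin k (Set.range fun j : (Σ e : ℕ, hirForms k p 𝔭 e) =>
      (∑ i, C ((j.2 : Fin (n + 1) → k) i) * X i ^ p ^ j.1 : MvPolynomial (Fin (n + 1)) k)) := by
  have hH := Hironaka1970_thm1_cor_holds p k n 𝔭 hP
  rw [hH]
  congr 1
  ext g
  constructor
  · rintro ⟨hgU, e, a, rfl⟩
    exact ⟨⟨e, ⟨a, (addForm_mem_multAlgebra_iff k p 𝔭).mp hgU⟩⟩, rfl⟩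
  · rintro ⟨⟨e, a⟩, rfl⟩
    exact ⟨(addForm_mem_multAlgebra_iff k p 𝔭).mpr a.2, e, a, rfl⟩

include hp in
/-- **`U(𝔭)` is a graded subalgebra** (for a point). [cite: Mizutani1973HironakaGroupSchemes, p. 85 L21 ("graded subalgebra U(p)")] -/
theorem isGradedSubalgebra_multAlgebra [𝔭.IsPrime] (hP : IsPoint k 𝔭) : IsGradedSubalgebra (multAlgebra k 𝔭) := by
  rw [multAlgebra_eq_adjoin_range k p 𝔭 hP]
  exact isGradedSubalgebra_adjoin_sum_C_mul_X_pow _ _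

include hp in
/-- **`U(𝔭)` is stable under all Hasse–Schmidt derivations `D^{(β)}`** (for a point; a corollary of generation by additive forms).
[cite: Dietel2015, Lemma (9.1.4) (proof: "D_M(f) ∈ (U_x)_{d−|M|}")] -/
theorem isDiffStable_multAlgebra [𝔭.IsPrime] (hP : IsPoint k 𝔭) : IsDiffStable (multAlgebra k 𝔭) := by
  haveI : ExpChar k p := ExpChar.prime hp.out
  rw [multAlgebra_eq_adjoin_range k p 𝔭 hP]
  exact isDiffStable_adjoin_sum_C_mul_X_pow p _ _

include hp in
/-- **Hironaka's triangular basis of `U(𝔭)` exists**: `U(𝔭) = k[σ_1, …, σ_r]`, `σ_j = X_{ι(j)}^{p^{e_j}} + Σ c_{jk} X_k^{p^{e_j}}`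
triangular, algebraically independent, `e_1 ≤ … ≤ e_r` (tree `TriangularPresentation`, over any field).
[cite: Hironaka1970AdditiveGroups, Th. 1; Giraud1975, §1.6 (3)] -/
theorem nonempty_triangularPresentation_multAlgebra [𝔭.IsPrime] (hP : IsPoint k 𝔭) :
    Nonempty (TriangularPresentation p (multAlgebra k 𝔭)) := by
  haveI : ExpChar k p := ExpChar.prime hp.out
  exact nonempty_triangularPresentation p _ (isGradedSubalgebra_multAlgebra k p 𝔭 hP) (isDiffStable_multAlgebra k p 𝔭 hP)

end Generation

/-! ## 2. Elimination along a triangular system of additive forms -/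

section Elimination

variable (k : Type u) [Field k] (p : ℕ) [hp : Fact p.Prime] [CharP k p] {n : ℕ}
  {U : Subalgebra k (MvPolynomial (Fin (n + 1)) k)}

omit hp [CharP k p] in
/-- The triangular generator `σ_j` is the additive form with coefficient vector `c_j` and level `e_j`. [folklore] -/
theorem gen_eq_addForm (P : TriangularPresentation p U) (j : Fin P.r) :
    P.gen j = addForm k p (P.expo j) (P.coef j) := rfl

/-- `σ_j^{p^m}` is the additive form of level `e_j + m` with coefficient vector `c_j^{[p^m]}`. [folklore] -/
theorem gen_pow_eq_addForm (P : TriangularPresentation p U) (j : Fin P.r) (m : ℕ) :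
    P.gen j ^ p ^ m = addForm k p (P.expo j + m) (frobVec k p m (P.coef j)) := by
  rw [gen_eq_addForm, addForm_pow_pow]

omit [CharP k p] in
/-- **`a ↦ Σ_i a_i X_i^{p^e}` is injective** (`expand (p^e) ∘ linForm`, both injective: tree `rootPart_expand`,
`linForm_injective`). [folklore] -/
theorem addForm_injective (e : ℕ) :
    Function.Injective (addForm k p e : (Fin (n + 1) → k) → MvPolynomial (Fin (n + 1)) k) := by
  intro a b h
  have hq : p ^ e ≠ 0 := pow_ne_zero _ hp.out.ne_zero
  have h' : expand (p ^ e) (linForm a) = expand (p ^ e) (linForm b) := by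
    rw [expand_linForm, expand_linForm]
    exact h
  have h'' := congrArg (rootPart k (n + 1) (p ^ e)) h'
  rw [rootPart_expand hq, rootPart_expand hq] at h''
  exact linForm_injective h''

/-- **ELIMINATION.** For every additive form `Σ c_i X_i^{p^e}` there is a reduced one — zero coefficient at each pivot `ι(j)`
with `e_j ≤ e` — differing from it by a `k`-combination of the `σ_j^{p^{e−e_j}}`, `e_j ≤ e` (subtract
`c_{ι(j)} σ_j^{p^{e−e_j}}` for `j = 1, …, r` in turn: `σ_j` has pivot coefficient `1` and involves no earlier pivot).
[cite: Giraud1975, §1.6 (3)] -/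
theorem exists_addForm_sub_mem_span (P : TriangularPresentation p U) (e : ℕ) (c : Fin (n + 1) → k) :
    ∃ c' : Fin (n + 1) → k, (∀ j : Fin P.r, P.expo j ≤ e → c' (P.pivot j) = 0) ∧
      addForm k p e c - addForm k p e c' ∈ Submodule.span k
        ((fun j : Fin P.r => P.gen j ^ p ^ (e - P.expo j)) '' {j | P.expo j ≤ e}) := by
  set W := Submodule.span k ((fun j : Fin P.r => P.gen j ^ p ^ (e - P.expo j)) '' {j | P.expo j ≤ e}) with hW
  -- induction on the number `t` of leading pivots already cleared
  suffices h : ∀ t : ℕ, ∃ c' : Fin (n + 1) → k, (∀ j : Fin P.r, (j : ℕ) < t → P.expo j ≤ e → c' (P.pivot j) = 0) ∧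
      addForm k p e c - addForm k p e c' ∈ W by
    obtain ⟨c', h1, h2⟩ := h P.r
    exact ⟨c', fun j hj => h1 j j.2 hj, h2⟩
  intro t
  induction t with
  | zero => exact ⟨c, fun j hj => absurd hj (Nat.not_lt_zero _), by rw [sub_self]; exact W.zero_mem⟩
  | succ t ih =>
    obtain ⟨c₁, h1, h2⟩ := ih
    by_cases ht : t < P.r
    · set j₀ : Fin P.r := ⟨t, ht⟩ with hj₀
      by_cases he : P.expo j₀ ≤ e
      · -- subtract `c₁(ι(j₀)) · σ_{j₀}^{p^{e - e_{j₀}}}`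
        refine ⟨c₁ - c₁ (P.pivot j₀) • frobVec k p (e - P.expo j₀) (P.coef j₀), ?_, ?_⟩
        · intro j hj hje
          rw [Pi.sub_apply, Pi.smul_apply, smul_eq_mul]
          rcases Nat.lt_succ_iff_lt_or_eq.mp hj with hlt | heq
          · -- an earlier pivot: `σ_{j₀}` does not involve it
            have hjj : j < j₀ := Fin.lt_def.mpr (by rw [hj₀]; exact hlt)
            rw [h1 j hlt hje, frobVec, P.coef_pivot_eq_zero j₀ j hjj, zero_pow (pow_ne_zero _ hp.out.ne_zero), mul_zero,
              sub_zero]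
          · -- the pivot `ι(j₀)` itself: coefficient `1`
            have hjj : j = j₀ := Fin.ext (by rw [hj₀]; exact heq)
            subst hjj
            rw [frobVec, P.coef_pivot, one_pow, mul_one, sub_self]
        · have hsub : ∀ a b : Fin (n + 1) → k, addForm k p e (a - b) = addForm k p e a - addForm k p e b := fun a b => by
            simp only [addForm, Pi.sub_apply, C_sub, sub_mul, Finset.sum_sub_distrib]
          have hsplit : addForm k p e c - addForm k p e (c₁ - c₁ (P.pivot j₀) • frobVec k p (e - P.expo j₀) (P.coef j₀)) =
              (addForm k p e c - addForm k p e c₁) +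
                c₁ (P.pivot j₀) • addForm k p e (frobVec k p (e - P.expo j₀) (P.coef j₀)) := by
            rw [hsub, addForm_smul, MvPolynomial.smul_eq_C_mul]
            ring
          rw [hsplit]
          refine W.add_mem h2 (W.smul_mem _ (Submodule.subset_span ⟨j₀, he, ?_⟩))
          show P.gen j₀ ^ p ^ (e - P.expo j₀) = addForm k p e (frobVec k p (e - P.expo j₀) (P.coef j₀))
          rw [gen_pow_eq_addForm, Nat.add_sub_cancel' he]
      · -- `e_{j₀} > e`: nothing to clear
        refine ⟨c₁, fun j hj hje => ?_, h2⟩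
        rcases Nat.lt_succ_iff_lt_or_eq.mp hj with hlt | heq
        · exact h1 j hlt hje
        · exact absurd hje (by rw [show j = j₀ from Fin.ext (by rw [hj₀]; exact heq)]; exact he)
    · -- `t ≥ r`: all pivots are below `t` already
      refine ⟨c₁, fun j hj hje => h1 j (lt_of_lt_of_le j.2 (not_lt.mp ht)) hje, h2⟩

/-- **A reduced additive form in the ideal `(σ_1, …, σ_r)` vanishes**: if `Σ c_i X_i^{p^e} ∈ (σ)` has zero coefficient at
every pivot `ι(j)` with `e_j ≤ e`, then it is `0` — its monomials `X_i^{p^e}` are standard (`i` a non-pivot, or a pivot with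
`p^e < q_j`), and standard monomials are independent modulo the Gröbner basis `σ`.
[cite: Giraud1975, §1.6 (3)–(4)] -/
theorem addForm_eq_zero_of_mem_span_range_gen (P : TriangularPresentation p U) {e : ℕ} {c : Fin (n + 1) → k}
    (hc : ∀ j : Fin P.r, P.expo j ≤ e → c (P.pivot j) = 0)
    (hmem : addForm k p e c ∈ Ideal.span (Set.range P.gen)) : addForm k p e c = 0 := by
  classical
  haveI : ExpChar k p := ExpChar.prime hp.out
  refine eq_zero_of_mem_span_of_forall_isTriStd P (fun s hs => ?_) hmem
  -- the support of `Σ c_i X_i^{p^e}` consists of `single i (p^e)` with `c_i ≠ 0`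
  have hs' : ∃ i, c i ≠ 0 ∧ s = Finsupp.single i (p ^ e) := by
    unfold addForm at hs
    obtain ⟨i, -, hi⟩ := Finset.mem_biUnion.mp (support_sum hs)
    rw [C_mul_X_pow_eq_monomial, support_monomial] at hi
    split_ifs at hi with h0
    · exact absurd hi (Finset.notMem_empty _)
    · exact ⟨i, h0, Finset.mem_singleton.mp hi⟩
  obtain ⟨i, hi, rfl⟩ := hs'
  intro j
  show (Finsupp.single i (p ^ e)) (P.pivot j) < p ^ P.expo j
  by_cases hij : P.pivot j = i
  · -- a pivot in the support forces `e < e_j`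
    have hlt : e < P.expo j := by
      by_contra hle
      exact hi (hij ▸ hc j (not_lt.mp hle))
    rw [hij, Finsupp.single_eq_same]
    exact Nat.pow_lt_pow_right hp.out.one_lt hlt
  · rw [Finsupp.single_eq_of_ne hij]
    exact pow_pos hp.out.pos _

/-- **An additive form in the ideal `(σ_1, …, σ_r)` is a `k`-combination of the `σ_j^{p^{e−e_j}}`, `e_j ≤ e`** — in
particular it lies in `U = k[σ]`: `L ∩ (σ)S = (k[F]·{σ_j})_+`. [cite: Giraud1975, §1.6 (3); Dietel2015, Lemma (9.1.4) ("R Q_x = Q_x")] -/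
theorem addForm_mem_span_pow_gen_of_mem (P : TriangularPresentation p U) {e : ℕ} {c : Fin (n + 1) → k}
    (hmem : addForm k p e c ∈ Ideal.span (Set.range P.gen)) :
    addForm k p e c ∈ Submodule.span k ((fun j : Fin P.r => P.gen j ^ p ^ (e - P.expo j)) '' {j | P.expo j ≤ e}) := by
  obtain ⟨c', hc', hW⟩ := exists_addForm_sub_mem_span k p P e c
  -- the span lies inside the ideal `(σ)`, so the reduced form is in `(σ)` too, hence `0`
  have hle : Submodule.span k ((fun j : Fin P.r => P.gen j ^ p ^ (e - P.expo j)) '' {j | P.expo j ≤ e}) ≤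
      (Ideal.span (Set.range P.gen)).restrictScalars k := by
    refine Submodule.span_le.mpr ?_
    rintro _ ⟨j, -, rfl⟩
    exact Ideal.pow_mem_of_mem (Ideal.span (Set.range P.gen)) (Ideal.subset_span (Set.mem_range_self j)) _
      (pow_pos hp.out.pos _)
  have hc'mem : addForm k p e c' ∈ Ideal.span (Set.range P.gen) := by
    have h := hle hW
    rw [Submodule.restrictScalars_mem] at h
    have h' : addForm k p e c - (addForm k p e c - addForm k p e c') ∈ Ideal.span (Set.range P.gen) := Ideal.sub_mem _ hmem h
    rwa [sub_sub_cancel] at h'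
  have h0 := addForm_eq_zero_of_mem_span_range_gen k p P hc' hc'mem
  rw [h0, sub_zero] at hW
  exact hW

omit hp [CharP k p] in
/-- The `σ_j^{p^{e−e_j}}` (`e_j ≤ e`) lie in `U`. [folklore] -/
theorem span_pow_gen_le (P : TriangularPresentation p U) (e : ℕ) :
    Submodule.span k ((fun j : Fin P.r => P.gen j ^ p ^ (e - P.expo j)) '' {j | P.expo j ≤ e}) ≤
      Subalgebra.toSubmodule U := by
  refine Submodule.span_le.mpr ?_
  rintro _ ⟨j, -, rfl⟩
  exact U.pow_mem (P.gen_mem j) _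

end Elimination

/-! ## 3. `U_+(𝔭)S = (σ)`, the additive forms of `U_+(𝔭)S`, and Giraud's algebra of invariants -/

section Point

variable (k : Type u) [Field k] (p : ℕ) [hp : Fact p.Prime] [CharP k p] {n : ℕ}
  (𝔭 : Ideal (MvPolynomial (Fin (n + 1)) k))

/-- **`U_+(𝔭)S = (σ_1, …, σ_r)`** for every triangular presentation `U(𝔭) = k[σ]` (the `σ_j` are constant-free generators).
[cite: Mizutani1973HironakaGroupSchemes, Def. 1.1 (U_+(p)S)] -/
theorem bIdeal_eq_span_range_gen (P : TriangularPresentation p (multAlgebra k 𝔭)) :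
    bIdeal k 𝔭 = Ideal.span (Set.range P.gen) := by
  haveI : ExpChar k p := ExpChar.prime hp.out
  have h0 : ∀ g ∈ Set.range P.gen, constantCoeff g = 0 := by
    rintro _ ⟨j, rfl⟩
    exact (isAdditive_gen P j).constantCoeff_eq_zero
  apply le_antisymm
  · refine Ideal.span_le.mpr ?_
    rintro u ⟨huU, hu0⟩
    have huU' : u ∈ Algebra.adjoin k (Set.range P.gen) := P.eq_adjoin ▸ huU
    have h := sub_C_constantCoeff_mem_ideal_span_of_mem_adjoin h0 huU'
    have hu0' : constantCoeff u = 0 := hu0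
    rwa [hu0', C_0, sub_zero] at h
  · refine Ideal.span_le.mpr ?_
    rintro _ ⟨j, rfl⟩
    exact Ideal.subset_span ⟨P.gen_mem j, h0 _ ⟨j, rfl⟩⟩

/-- **`L_e ∩ U_+(𝔭)S ⊆ U(𝔭)`: an additive form in the ideal of `B_{P,𝔭}` has multiplicity `p^e` at `𝔭`**, i.e. its
coefficient vector lies in `hirForms k p 𝔭 e = (U(𝔭) ∩ L)_e` (for a point `𝔭`).
[cite: Dietel2015, Lemma (9.1.4) (Q_x = U_x ∩ L, R Q_x = Q_x); Mizutani1973HironakaGroupSchemes, §1 (c)] -/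
theorem mem_hirForms_of_addForm_mem_bIdeal [𝔭.IsPrime] (hP : IsPoint k 𝔭) {e : ℕ} {c : Fin (n + 1) → k}
    (h : addForm k p e c ∈ bIdeal k 𝔭) : c ∈ hirForms k p 𝔭 e := by
  obtain ⟨P⟩ := nonempty_triangularPresentation_multAlgebra k p 𝔭 hP
  rw [bIdeal_eq_span_range_gen k p 𝔭 P] at h
  have hU : addForm k p e c ∈ multAlgebra k 𝔭 := span_pow_gen_le k p P e (addForm_mem_span_pow_gen_of_mem k p P h)
  exact (addForm_mem_multAlgebra_iff k p 𝔭).mp hU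

/-- **`L_e ∩ U_+(𝔭)S = (U(𝔭) ∩ L)_e`**: `Σ c_i X_i^{p^e} ∈ U_+(𝔭)S ↔ c ∈ hirForms k p 𝔭 e` (for a point `𝔭`).
[cite: Dietel2015, Lemma (9.1.4); Mizutani1973HironakaGroupSchemes, §1 (c)] -/
theorem addForm_mem_bIdeal_iff [𝔭.IsPrime] (hP : IsPoint k 𝔭) {e : ℕ} {c : Fin (n + 1) → k} :
    addForm k p e c ∈ bIdeal k 𝔭 ↔ c ∈ hirForms k p 𝔭 e := by
  refine ⟨mem_hirForms_of_addForm_mem_bIdeal k p 𝔭 hP, fun hc => ?_⟩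
  refine famIdeal_hirForms_le_bIdeal k p 𝔭 ?_
  exact Ideal.subset_span (Set.mem_iUnion.mpr ⟨e, c, hc, rfl⟩)

/-- **`(U(𝔭) ∩ L)_e` is spanned by the coefficient vectors `c_j^{[p^{e−e_j}]}` of the `σ_j^{p^{e−e_j}}`, `e_j ≤ e`.**
[cite: Giraud1975, §1.6 (3); Mizutani1973HironakaGroupSchemes, §1 (c)] -/
theorem hirForms_eq_span_coef_pow [𝔭.IsPrime] (P : TriangularPresentation p (multAlgebra k 𝔭)) (e : ℕ) :
    hirForms k p 𝔭 e = Submodule.span k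
      ((fun j : Fin P.r => frobVec k p (e - P.expo j) (P.coef j)) '' {j | P.expo j ≤ e}) := by
  apply le_antisymm
  · intro c hc
    have hmem : addForm k p e c ∈ Ideal.span (Set.range P.gen) := by
      rw [← bIdeal_eq_span_range_gen k p 𝔭 P]
      exact famIdeal_hirForms_le_bIdeal k p 𝔭 (Ideal.subset_span (Set.mem_iUnion.mpr ⟨e, c, hc, rfl⟩))
    have h := addForm_mem_span_pow_gen_of_mem k p P hmem
    -- transport along the `k`-linear injection `addFormLin e`
    have himage : (fun j : Fin P.r => P.gen j ^ p ^ (e - P.expo j)) '' {j | P.expo j ≤ e} =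
        addFormLin k p e '' ((fun j : Fin P.r => frobVec k p (e - P.expo j) (P.coef j)) '' {j | P.expo j ≤ e}) := by
      rw [Set.image_image]
      refine Set.image_congr fun j hj => ?_
      have hj' : P.expo j ≤ e := hj
      rw [addFormLin_apply, gen_pow_eq_addForm, Nat.add_sub_cancel' hj']
    rw [himage, Submodule.span_image, ← addFormLin_apply] at h
    obtain ⟨y, hy, hyc⟩ := Submodule.mem_map.mp h
    rw [addFormLin_apply, addFormLin_apply] at hyc
    rwa [← addForm_injective k p e hyc]
  · refine Submodule.span_le.mpr ?_
    rintro _ ⟨j, hj, rfl⟩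
    have h : P.gen j ^ p ^ (e - P.expo j) ∈ multAlgebra k 𝔭 := (multAlgebra k 𝔭).pow_mem (P.gen_mem j) _
    rw [gen_pow_eq_addForm, Nat.add_sub_cancel' (by exact hj)] at h
    exact (addForm_mem_multAlgebra_iff k p 𝔭).mp h

/-- **`U(𝔭)` is Giraud's algebra of invariants of `B_{P,𝔭}`**: the subalgebra generated by the additive forms of the ridge
ideal of `B_{P,𝔭}` (tree `ridgeAlgebra p (bIdeal k 𝔭)`; the ridge ideal is `U_+(𝔭)S` itself, `ridgeIdeal_bIdeal`) is `U(𝔭)`.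
[cite: Giraud1975, §1.5 ("U l'algèbre des invariants de F"); Dietel2015, Def. (9.1.5) and p. 6] -/
theorem ridgeAlgebra_bIdeal_eq_multAlgebra [𝔭.IsPrime] (hP : IsPoint k 𝔭) :
    ridgeAlgebra p (bIdeal k 𝔭) = multAlgebra k 𝔭 := by
  apply le_antisymm
  · refine Algebra.adjoin_le ?_
    rintro _ ⟨j, rfl⟩
    have hj : addForm k p j.1.2 j.1.1 ∈ bIdeal k 𝔭 := (ridgeIdeal_bIdeal k p 𝔭 hP).le j.2
    show addForm k p j.1.2 j.1.1 ∈ multAlgebra k 𝔭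
    exact (addForm_mem_multAlgebra_iff k p 𝔭).mpr (mem_hirForms_of_addForm_mem_bIdeal k p 𝔭 hP hj)
  · rw [multAlgebra_eq_adjoin_range k p 𝔭 hP]
    refine Algebra.adjoin_le ?_
    rintro _ ⟨⟨e, a⟩, rfl⟩
    have ha : (∑ i, C ((a : Fin (n + 1) → k) i) * X i ^ p ^ e : MvPolynomial (Fin (n + 1)) k) ∈ ridgeIdeal (bIdeal k 𝔭) := by
      rw [ridgeIdeal_bIdeal k p 𝔭 hP, ← addForm_eq_sum]
      exact (addForm_mem_bIdeal_iff k p 𝔭 hP).mpr a.2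
    exact Algebra.subset_adjoin ⟨⟨((a : Fin (n + 1) → k), e), ha⟩, rfl⟩

end Point

end Summit.ResolutionOfSingularities.KangarooAtlas.Mizutani

end
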